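import Mathlib
import Summits.HodgeConjecture.HodgeConjecture.Theorems.WeilTwelvefoldsSqrtMinus7.Negative.EigenvalueTyping

/-!
# Abstract quaternion field switch · quaternion normal form (step (a))

Helper file for the stub `stub_abstractSwitch` (line `Sketch`, idea `dicyclic-quaternion-switch`,
crux `HeckePrymWeil.HyperbolicEightfoldsSqrtMinus7`, item stmt-HodgeConjecture-14642).

For `F² = -7`, `G² = -3m²`, `FG + GF = t`, `t² < 84m²` on a 16-dimensional complex vector space `V`:
`G₁ := G + (t/14) F` anticommutes with `F` and `G₁² = -r²`, `r² = 3m² - t²/28 ≠ 0`; `F` is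
diagonalisable with eigenvalues `± i√7`, `V = V⁺ ⊕ V⁻`, `G₁` swaps `V⁺` and `V⁻`, so
`dim V⁺ = dim V⁻ = 8`; a basis `u` of `V⁺` and `w := G₁ ∘ u` give a basis of `V` in which every
element of `ℂ⟨F, G⟩ ≅ M₂(ℂ)` acts as `M ⊗ 1` (`normalForm_basis`).
-/

-- `Summit.HodgeConjecture.HodgeConjecture.…` is the tree's mandated namespace (summit = problem name).
set_option linter.dupNamespace false

namespace Summit.HodgeConjecture.HodgeConjecture.Theorems.HyperbolicEightfoldsSqrtMinus7.DicyclicQuaternionSwitch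

open Module Complex
open Summit.HodgeConjecture.HodgeConjecture.Theorems.WeilTwelvefoldsSqrtMinus7.Negative

/-- `i√7`, spelled as in the crux. -/
local notation "𝕒" => (Complex.I * ((Real.sqrt (7 : ℝ) : ℝ) : ℂ))

/-- `(i√7)·(i√7) = -7`. [folklore] -/
theorem rt7_mul_self : 𝕒 * 𝕒 = -7 := by
  rw [I_mul_sqrt7_mul_self]; push_cast; ring

/-- `i√7 ≠ 0`. [folklore] -/
theorem rt7_ne_zero : 𝕒 ≠ 0 := mul_ne_zero I_ne_zero sqrt7_ne_zero

/-- `k - i√7 ≠ 0` for a natural number `k` (imaginary part `-√7`). [folklore] -/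
theorem natCast_sub_rt7_ne_zero (k : ℕ) : (k : ℂ) - 𝕒 ≠ 0 := by
  intro h
  have := congrArg Complex.im h
  simp at this

section F

variable {V : Type} [AddCommGroup V] [Module ℂ V] (F : V →ₗ[ℂ] V)

/-- Pointwise `F² = -7`. [folklore] -/
theorem sq_apply_of_sq_eq (hF : F ∘ₗ F = -((7 : ℂ) • LinearMap.id)) (v : V) : F (F v) = -((7 : ℂ) • v) := by
  simpa using LinearMap.congr_fun hF v

/-- `F v + i√7 v ∈ V⁺ = ker (F - i√7)` when `F² = -7`. [folklore] -/
theorem add_mem_eigenspace_pos (hF : F ∘ₗ F = -((7 : ℂ) • LinearMap.id)) (v : V) :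
    F v + 𝕒 • v ∈ Module.End.eigenspace F 𝕒 := by
  rw [Module.End.mem_eigenspace_iff, map_add, map_smul, sq_apply_of_sq_eq F hF, smul_add, smul_smul,
    rt7_mul_self]
  module

/-- `F v - i√7 v ∈ V⁻ = ker (F + i√7)` when `F² = -7`. [folklore] -/
theorem sub_mem_eigenspace_neg (hF : F ∘ₗ F = -((7 : ℂ) • LinearMap.id)) (v : V) :
    F v - 𝕒 • v ∈ Module.End.eigenspace F (-𝕒) := by
  rw [Module.End.mem_eigenspace_iff, map_sub, map_smul, sq_apply_of_sq_eq F hF, smul_sub, smul_smul,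
    neg_mul, rt7_mul_self]
  module

/-- `V = V⁺ + V⁻` when `F² = -7`. [folklore] -/
theorem eigenspace_pos_sup_neg (hF : F ∘ₗ F = -((7 : ℂ) • LinearMap.id)) :
    Module.End.eigenspace F 𝕒 ⊔ Module.End.eigenspace F (-𝕒) = ⊤ := by
  rw [eq_top_iff]
  intro v _
  rw [Submodule.mem_sup]
  refine ⟨(2 * 𝕒)⁻¹ • (F v + 𝕒 • v), Submodule.smul_mem _ _ (add_mem_eigenspace_pos F hF v),
    -((2 * 𝕒)⁻¹ • (F v - 𝕒 • v)), Submodule.neg_mem _ (Submodule.smul_mem _ _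
      (sub_mem_eigenspace_neg F hF v)), ?_⟩
  rw [← sub_eq_add_neg, ← smul_sub, show F v + 𝕒 • v - (F v - 𝕒 • v) = (2 * 𝕒) • v by module,
    smul_smul, inv_mul_cancel₀ (mul_ne_zero two_ne_zero rt7_ne_zero), one_smul]

/-- `V⁺ ∩ V⁻ = 0`. [folklore] -/
theorem disjoint_eigenspace_pos_neg :
    Disjoint (Module.End.eigenspace F 𝕒) (Module.End.eigenspace F (-𝕒)) := by
  rw [Submodule.disjoint_def]
  intro v h₁ h₂
  rw [Module.End.mem_eigenspace_iff] at h₁ h₂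
  have h : (2 * 𝕒) • v = 0 := by
    rw [mul_smul, two_smul]
    nth_rewrite 1 [← h₁]
    rw [h₂]
    module
  exact (smul_eq_zero.1 h).resolve_left (mul_ne_zero two_ne_zero rt7_ne_zero)

/-- `dim V⁺ + dim V⁻ = dim V` when `F² = -7`. [folklore] -/
theorem finrank_eigenspace_pos_add_neg [FiniteDimensional ℂ V] (hF : F ∘ₗ F = -((7 : ℂ) • LinearMap.id)) :
    Module.finrank ℂ (Module.End.eigenspace F 𝕒) + Module.finrank ℂ (Module.End.eigenspace F (-𝕒)) =
      Module.finrank ℂ V := by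
  have h := Submodule.finrank_sup_add_finrank_inf_eq (Module.End.eigenspace F 𝕒)
    (Module.End.eigenspace F (-𝕒))
  rw [eigenspace_pos_sup_neg F hF, (disjoint_eigenspace_pos_neg F).eq_bot, finrank_top, finrank_bot,
    add_zero] at h
  exact h.symm

end F

section FG

variable {V : Type} [AddCommGroup V] [Module ℂ V] (F G : V →ₗ[ℂ] V) (m : ℕ) (t : ℤ)

/-- **Anticommutation.**  With `F² = -7` and `FG + GF = t`, the corrected operator `G₁ = G + (t/14) F`
anticommutes with `F`. [folklore] -/
theorem anticommute_corrected (hF : F ∘ₗ F = -((7 : ℂ) • LinearMap.id))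
    (hFG : F ∘ₗ G + G ∘ₗ F = (t : ℂ) • LinearMap.id) (v : V) :
    F ((G + ((t : ℂ) / 14) • F) v) = -((G + ((t : ℂ) / 14) • F) (F v)) := by
  have h := LinearMap.congr_fun hFG v
  simp only [LinearMap.add_apply, LinearMap.comp_apply, LinearMap.smul_apply, LinearMap.id_apply] at h
  simp only [LinearMap.add_apply, LinearMap.smul_apply, map_add, map_smul, sq_apply_of_sq_eq F hF]
  rw [← sub_eq_zero]
  have h' : F (G v) + G (F v) - (t : ℂ) • v = 0 := by rw [h, sub_self]
  rw [← h']
  module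

/-- **Square of the corrected operator.**  With `F² = -7`, `G² = -3m²`, `FG + GF = t`:
`G₁² = -(3m² - t²/28)`. [folklore] -/
theorem corrected_sq (hF : F ∘ₗ F = -((7 : ℂ) • LinearMap.id))
    (hG : G ∘ₗ G = -((3 * (m : ℂ) ^ 2) • LinearMap.id))
    (hFG : F ∘ₗ G + G ∘ₗ F = (t : ℂ) • LinearMap.id) (v : V) :
    (G + ((t : ℂ) / 14) • F) ((G + ((t : ℂ) / 14) • F) v) =
      -((3 * (m : ℂ) ^ 2 - (t : ℂ) ^ 2 / 28) • v) := by
  have h := LinearMap.congr_fun hFG v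
  simp only [LinearMap.add_apply, LinearMap.comp_apply, LinearMap.smul_apply, LinearMap.id_apply] at h
  have hGG : G (G v) = -((3 * (m : ℂ) ^ 2) • v) := by simpa using LinearMap.congr_fun hG v
  simp only [LinearMap.add_apply, LinearMap.smul_apply, map_add, map_smul, sq_apply_of_sq_eq F hF, hGG]
  rw [← sub_eq_zero]
  have h' : ((t : ℂ) / 14) • (F (G v) + G (F v) - (t : ℂ) • v) = 0 := by rw [h, sub_self, smul_zero]
  rw [← h']
  module

/-- `r² = 3m² - t²/28 ≠ 0` when `t² < 84m²`. [folklore] -/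
theorem rsq_ne_zero (ht : t ^ 2 < 84 * (m : ℤ) ^ 2) : (3 * (m : ℂ) ^ 2 - (t : ℂ) ^ 2 / 28) ≠ 0 := by
  have hz : (84 * (m : ℤ) ^ 2 - t ^ 2 : ℤ) ≠ 0 := by omega
  have hc : ((84 * (m : ℤ) ^ 2 - t ^ 2 : ℤ) : ℂ) ≠ 0 := Int.cast_ne_zero.2 hz
  push_cast at hc
  intro h
  apply hc
  linear_combination 28 * h

/-- The corrected operator is injective (`G₁² = -r²`, `r² ≠ 0`). [folklore] -/
theorem corrected_injective (hF : F ∘ₗ F = -((7 : ℂ) • LinearMap.id))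
    (hG : G ∘ₗ G = -((3 * (m : ℂ) ^ 2) • LinearMap.id))
    (hFG : F ∘ₗ G + G ∘ₗ F = (t : ℂ) • LinearMap.id) (ht : t ^ 2 < 84 * (m : ℤ) ^ 2) :
    Function.Injective (G + ((t : ℂ) / 14) • F) := by
  rw [← LinearMap.ker_eq_bot, Submodule.eq_bot_iff]
  intro v hv
  rw [LinearMap.mem_ker] at hv
  have h := corrected_sq F G m t hF hG hFG v
  rw [hv, map_zero] at h
  have h' : (3 * (m : ℂ) ^ 2 - (t : ℂ) ^ 2 / 28) • v = 0 := by
    rw [← neg_eq_zero, ← h]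
  exact (smul_eq_zero.1 h').resolve_left (rsq_ne_zero m t ht)

/-- `G₁` maps `V^{±} ` to `V^{∓}` (anticommutation). [folklore] -/
theorem corrected_mem_eigenspace_neg (hF : F ∘ₗ F = -((7 : ℂ) • LinearMap.id))
    (hFG : F ∘ₗ G + G ∘ₗ F = (t : ℂ) • LinearMap.id) {μ : ℂ} {v : V}
    (hv : v ∈ Module.End.eigenspace F μ) :
    (G + ((t : ℂ) / 14) • F) v ∈ Module.End.eigenspace F (-μ) := by
  rw [Module.End.mem_eigenspace_iff] at hv ⊢
  rw [anticommute_corrected F G t hF hFG v, hv, map_smul, neg_smul]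

/-- **`dim V⁺ = 8`** (and `dim V⁻ = 8`): `G₁` embeds `V⁺` into `V⁻` and `V⁻` into `V⁺`, and
`dim V⁺ + dim V⁻ = 16`. [folklore] -/
theorem finrank_eigenspace_eq_eight [FiniteDimensional ℂ V] (hV : Module.finrank ℂ V = 16)
    (hF : F ∘ₗ F = -((7 : ℂ) • LinearMap.id))
    (hG : G ∘ₗ G = -((3 * (m : ℂ) ^ 2) • LinearMap.id))
    (hFG : F ∘ₗ G + G ∘ₗ F = (t : ℂ) • LinearMap.id) (ht : t ^ 2 < 84 * (m : ℤ) ^ 2) (μ : ℂ)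
    (hμ : μ = 𝕒 ∨ μ = -𝕒) :
    Module.finrank ℂ (Module.End.eigenspace F μ) = 8 := by
  set e := LinearEquiv.ofInjectiveEndo _ (corrected_injective F G m t hF hG hFG ht) with he
  have hle : ∀ ν : ℂ, Module.finrank ℂ (Module.End.eigenspace F ν) ≤
      Module.finrank ℂ (Module.End.eigenspace F (-ν)) := by
    intro ν
    rw [← LinearEquiv.finrank_map_eq e (Module.End.eigenspace F ν)]
    apply Submodule.finrank_mono
    rintro _ ⟨v, hv, rfl⟩
    exact corrected_mem_eigenspace_neg F G t hF hFG hv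
  have hsum := finrank_eigenspace_pos_add_neg F hF
  rw [hV] at hsum
  have h₁ := hle 𝕒
  have h₂ := hle (-𝕒)
  rw [neg_neg] at h₂
  rcases hμ with rfl | rfl <;> omega

end FG

/-- **The adapted half-bases (quaternion normal form, step (a) of the abstract switch).**  For
`F² = -7`, `G² = -3m²`, `FG + GF = t`, `t² < 84m²` on a 16-dimensional `V` there is a linearly
independent family `u : Fin 8 → V` of `i√7`-eigenvectors of `F` (a basis of `V⁺`) such that
`G₁ ∘ u`, `G₁ = G + (t/14)F`, is linearly independent (a basis of `V⁻`) with span disjoint from the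
span of `u`; in the basis `(u, G₁u)` every element of `ℂ⟨F, G⟩` acts as a `2 × 2` matrix `⊗ 1`.
[folklore] -/
theorem exists_half_bases :
    ∀ {V : Type} [AddCommGroup V] [Module ℂ V] [FiniteDimensional ℂ V] (F G : V →ₗ[ℂ] V) (m : ℕ)
      (t : ℤ), Module.finrank ℂ V = 16 → F ∘ₗ F = -((7 : ℂ) • LinearMap.id) →
      G ∘ₗ G = -((3 * (m : ℂ) ^ 2) • LinearMap.id) → F ∘ₗ G + G ∘ₗ F = (t : ℂ) • LinearMap.id →
      t ^ 2 < 84 * (m : ℤ) ^ 2 →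
    ∃ u : Fin 8 → V, (∀ i, F (u i) = (Complex.I * ((Real.sqrt (7 : ℝ) : ℝ) : ℂ)) • u i) ∧
      LinearIndependent ℂ u ∧ LinearIndependent ℂ (fun i => (G + ((t : ℂ) / 14) • F) (u i)) ∧
      Disjoint (Submodule.span ℂ (Set.range u))
        (Submodule.span ℂ (Set.range fun i => (G + ((t : ℂ) / 14) • F) (u i))) := by
  intro V _ _ _ F G m t hV hF hG hFG ht
  set Vp := Module.End.eigenspace F 𝕒 with hVp
  have h8 : Module.finrank ℂ Vp = 8 := finrank_eigenspace_eq_eight F G m t hV hF hG hFG ht _ (Or.inl rfl)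
  set u₀ := Module.finBasisOfFinrankEq ℂ Vp h8 with hu₀
  refine ⟨fun i => (u₀ i : V), fun i => Module.End.mem_eigenspace_iff.1 (u₀ i).2, ?_, ?_, ?_⟩
  · exact u₀.linearIndependent.map' Vp.subtype Vp.ker_subtype
  · exact (u₀.linearIndependent.map' Vp.subtype Vp.ker_subtype).map' _
      (LinearMap.ker_eq_bot.2 (corrected_injective F G m t hF hG hFG ht))
  · refine (disjoint_eigenspace_pos_neg F).mono ?_ ?_
    · rw [Submodule.span_le]
      rintro _ ⟨i, rfl⟩
      exact (u₀ i).2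
    · rw [Submodule.span_le]
      rintro _ ⟨i, rfl⟩
      exact corrected_mem_eigenspace_neg F G t hF hFG (u₀ i).2

/-- **A basis of `V` from two half-families.**  If `u, w : Fin 8 → V` are linearly independent with
disjoint spans in a 16-dimensional space, there is a basis `b` of `V` indexed by `Fin (8 + 8)` with
first half `u` and second half `w`. [folklore] -/
theorem exists_basis_of_halves {V : Type} [AddCommGroup V] [Module ℂ V] [FiniteDimensional ℂ V]
    (hV : Module.finrank ℂ V = 16) (u w : Fin 8 → V) (hu : LinearIndependent ℂ u)
    (hw : LinearIndependent ℂ w)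
    (hd : Disjoint (Submodule.span ℂ (Set.range u)) (Submodule.span ℂ (Set.range w))) :
    ∃ b : Module.Basis (Fin (8 + 8)) ℂ V,
      (∀ i, b (Fin.castAdd 8 i) = u i) ∧ (∀ i, b (Fin.natAdd 8 i) = w i) := by
  have hli : LinearIndependent ℂ (Sum.elim u w ∘ finSumFinEquiv.symm) :=
    (hu.sum_type hw hd).comp _ finSumFinEquiv.symm.injective
  refine ⟨basisOfLinearIndependentOfCardEqFinrank hli (by simp [hV]), fun i => ?_, fun i => ?_⟩
  · rw [coe_basisOfLinearIndependentOfCardEqFinrank, Function.comp_apply,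
      finSumFinEquiv_symm_apply_castAdd, Sum.elim_inl]
  · rw [coe_basisOfLinearIndependentOfCardEqFinrank, Function.comp_apply,
      finSumFinEquiv_symm_apply_natAdd, Sum.elim_inr]

end Summit.HodgeConjecture.HodgeConjecture.Theorems.HyperbolicEightfoldsSqrtMinus7.DicyclicQuaternionSwitch
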